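import Summits.BirchSwinnertonDyer.BirchSwinnertonDyer.Theorems.GenusKolyvaginAtTwoEquivariantKolyvaginExactAtTwoTwinDualityRat
import Summits.BirchSwinnertonDyer.BirchSwinnertonDyer.Theorems.ByReductionTypeAtTwoRankOneAtTwoOffBigImageOddLocalEngineRegularLocalStructure
import Summits.BirchSwinnertonDyer.BirchSwinnertonDyer.Theorems.ByReductionTypeAtTwoRankOneAtTwoOffBigImageOddLocalEngineRegularTwin
import HarnessLib

/-!
# Route `ByReductionTypeAtTwo`, crux `RankOneAtTwoOffBigImageOddLocal` (stmt-BirchSwinnertonDyer-23716), line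
# `refined_kolyvagin_tamagawa_shift_at_two`, stub `stub_sigmaShiftPosDisc`: McCallum's Lemma 5.3 + Prop. 2.2 over `ℚ_ℓ` at `p = 2`, UNCONDITIONAL
# form (GK2's fields `duality₁` / `duality₂` of the pair descent), at a **REGULAR** Kolyvagin prime — for `E` and for its twin; no sign condition on `Δ`

Lead prover `prover-cruxlead-stmt-BirchSwinnertonDyer-23716-g4` (2026-08-28; `--supports` the crux, closes nothing).  Seventh regular-engine CONSUMER.
The sibling route's `GenusExact.FrobeniusCriterion.lemma_5_3_rat_two` (file `…DualityRat`, seat `bsd-line-gk2-p3`) is the HYPOTHESIS-FREE Lemma 5.3 at 2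
over `ℚ_ℓ` (Tate local duality off `2`, Milne I 3.3, Poitou–Tate over `ℚ`, counting): its ONLY `Δ < 0` / `Frob(ℓ) = Frob(∞)` input is the count
`#E(ℚ_ℓ)[2^M] = 2^M`, supplied here by `…EngineRegularLocalStructure.natCard_ker_zsmul_adicCompletion_two_pow_eq_regular` (p666897) at a REGULAR
Kolyvagin prime; `…TwinDualityRat.lemma_5_3_rat_two_quadraticTwist` likewise for the twin equation, its count supplied through the regular twin transfer
`…EngineRegularTwin.regularFrobDatum_two_of_smul_quadraticTwist_eq` (p667224).

* `lemma_5_3_rat_two_regular` — `duality₁` at a regular Kolyvagin prime of index `≥ M` (any sign of `Δ`);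
* `natCard_ker_nsmul_quadraticTwist_adicCompletion_two_pow_eq_regular` — `#E^{(d_K)}(ℚ_ℓ)[2^M] = 2^M` for the twist EQUATION at such a prime;
* `lemma_5_3_rat_two_quadraticTwist_regular` — `duality₂`.

Both carry the sibling's ARCHIMEDEAN hypothesis `hdinf : ∀ w : InfinitePlace ℚ, d ∈ selmerLocalKer W w.Completion q` VERBATIM: on `Δ < 0` it is
vacuous (`…ArchimedeanSelmerLevel`), on this line's cell `Δ > 0` it is the located non-port (memo `Cruxes/…/SigmaShiftPosDiscArchimedean.md`:
`H¹(ℝ, E)[2] = π₀(E^{(−1)}(ℝ))^∨ = ℤ/2`).  THEOREMS ONLY (no definition, no named fact, no `sorry`, standard axioms).  BSD is not proved by any of this;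
the crux is not proved; the stub is not proved.

References: [McCallumLMS1991] §5 Lemma 5.3, §2 Prop. 2.2; [GrossLMS1991] Prop. 8.2, §3 (3.2)–(3.3); [MilneADT2006] Ch. I Cor. 3.4, Lemma 3.3, Thm. 4.10(b);
[WZhang2014] Notations (xii); [SilvermanAEC2009] X.5 Cor. 5.4.
-/

set_option autoImplicit false
set_option linter.dupNamespace false -- tree convention: `Summit.BirchSwinnertonDyer.BirchSwinnertonDyer.Theorems` (summit = sub-problem)

noncomputable section

open scoped Classical

namespace Summit.BirchSwinnertonDyer.BirchSwinnertonDyer.Theorems.OffBigImageOddLocalAtTwo.Engine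

open WeierstrassCurve NumberField IsDedekindDomain Field
open Literature.NumberTheory.EllipticCurves Literature.NumberTheory.GaloisRepresentations
open Summit.BirchSwinnertonDyer.BirchSwinnertonDyer.Theorems.GenusExact.FrobeniusCriterion
open Summit.BirchSwinnertonDyer.BirchSwinnertonDyer.Theorems.GenusExact.TwinGrossPrimes

variable (W : WeierstrassCurve ℚ) [W.IsElliptic] [W.IsGloballyMinimal] {K : Type} [Field K] [NumberField K]

/-- **`duality₁` at a REGULAR Kolyvagin prime — McCallum's Lemma 5.3 with Prop. 2.2 over `ℚ_ℓ` at `p = 2`, unconditional form, any sign of `Δ`.**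
`E = W/ℚ` globally minimal, `q = 2^M` (`M ≥ 1`), `ℓ` an odd prime of good reduction of Kolyvagin index `≥ M` whose Frobenius (at some `𝔓 ∣ ℓ`) is an
involution of `E[2]` moving a point; `s ∈ Sel^{(q)}(E/ℚ)`, `d ∈ H¹(ℚ, E[q])` Selmer at the finite places `≠ v` and at `∞`, `2^a d` NOT Selmer at `v ∋ ℓ`.
CONCLUSION: **`2^{M−1−a}·s ∈ torsionLocalKer_v`**.  (The sibling's `lemma_5_3_rat_two_of_card` with the regular count.)
[cite: McCallumLMS1991, §5 Lemma 5.3, §2 Prop. 2.2] [cite: MilneADT2006, Ch. I Cor. 3.4] -/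
theorem lemma_5_3_rat_two_regular {M : ℕ} (hM : 1 ≤ M) {q : ℕ}
    (hq : q = 2 ^ M) [NeZero q] {ℓ : ℕ} [Fact ℓ.Prime] (hℓ2 : ℓ ≠ 2) {v : HeightOneSpectrum (𝓞 ℚ)}
    (hℓv : (ℓ : 𝓞 ℚ) ∈ v.asIdeal) (hgood : W.HasGoodReductionAtPrime ℓ)
    (hreg : ∃ (𝔓 : Ideal (absIntegers (𝓞 ℚ) ℚ)) (h : absoluteGaloisGroup ℚ), 𝔓 ∈ v.primesAbove ∧
      IsArithFrobAt (𝓞 ℚ) h 𝔓 ∧ (∀ P : geomTorsion W ((2 : ℕ) : ℤ), h • h • P = P) ∧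
      ∃ u : geomTorsion W ((2 : ℕ) : ℤ), h • u ≠ u)
    (hMℓ : M ≤ Zhang2014.kolyvaginIndex W 2 ℓ)
    {s : galH1Torsion W (q : ℤ)} (hs : s ∈ selmerGroup W (q : ℤ))
    {d : galH1Torsion W (q : ℤ)}
    (hdfin : ∀ w : HeightOneSpectrum (𝓞 ℚ), w ≠ v → d ∈ selmerLocalKer W (w.adicCompletion ℚ) (q : ℤ))
    (hdinf : ∀ w : InfinitePlace ℚ, d ∈ selmerLocalKer W w.Completion (q : ℤ))
    {a : ℕ} (hdv : ((2 : ℤ) ^ a) • d ∉ selmerLocalKer W (v.adicCompletion ℚ) (q : ℤ)) :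
    ((2 : ℤ) ^ (M - 1 - a)) • s ∈ W.torsionLocalKer (v.adicCompletion ℚ) (q : ℤ) := by
  refine lemma_5_3_rat_two_of_card W hM hq hℓ2 hℓv ?_ hs hdfin hdinf hdv
  rw [hq, ← zsmulAddGroupHom_natCast]
  exact natCard_ker_zsmul_adicCompletion_two_pow_eq_regular W hℓ2 hgood hℓv hreg hMℓ

/-- **`#E^{(d_K)}(ℚ_ℓ)[2^M] = 2^M` for the twist EQUATION `W.quadraticTwist d_K`** at a REGULAR Kolyvagin prime `ℓ` of `E` of index `≥ M` (`K` quadratic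
with `d_K` odd, `ℓ` odd of good reduction for `E`, `ℓ ∤ d_K`; any sign of `Δ`): the regular datum moves to a globally minimal model of the twist
(`regularFrobDatum_two_of_smul_quadraticTwist_eq`), which has good reduction at `ℓ` and the same Kolyvagin index; count there
(`natCard_ker_zsmul_adicCompletion_two_pow_eq_regular`) and transport back along the change of variables.
[cite: McCallumLMS1991, §5 Lemma 5.3] [cite: WZhang2014, Notations (xii)] [cite: SilvermanAEC2009, X.5 Cor. 5.4] -/
theorem natCard_ker_nsmul_quadraticTwist_adicCompletion_two_pow_eq_regular (h2 : Module.finrank ℚ K = 2)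
    (hodd : Odd (NumberField.discr K)) [(W.quadraticTwist ((NumberField.discr K : ℤ) : ℚ)).IsElliptic]
    {ℓ : ℕ} [Fact ℓ.Prime] (hℓ2 : ℓ ≠ 2) (hℓd : ¬ ((ℓ : ℤ) ∣ NumberField.discr K))
    (hgoodℓ : W.HasGoodReductionAtPrime ℓ) {v : HeightOneSpectrum (𝓞 ℚ)} (hv : (ℓ : 𝓞 ℚ) ∈ v.asIdeal)
    (hreg : ∃ (𝔓 : Ideal (absIntegers (𝓞 ℚ) ℚ)) (h : absoluteGaloisGroup ℚ), 𝔓 ∈ v.primesAbove ∧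
      IsArithFrobAt (𝓞 ℚ) h 𝔓 ∧ (∀ P : geomTorsion W ((2 : ℕ) : ℤ), h • h • P = P) ∧
      ∃ u : geomTorsion W ((2 : ℕ) : ℤ), h • u ≠ u)
    {M : ℕ} (hM : M ≤ Zhang2014.kolyvaginIndex W 2 ℓ) {q : ℕ} (hq : q = 2 ^ M) :
    Nat.card (nsmulAddMonoidHom q :
        ((W.quadraticTwist ((NumberField.discr K : ℤ) : ℚ)).baseChange (v.adicCompletion ℚ)).toAffine.Point →+
          _).ker = 2 ^ M := by
  have hd : ((NumberField.discr K : ℤ) : ℚ) ≠ 0 := by exact_mod_cast NumberField.discr_ne_zero K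
  obtain ⟨C, hC⟩ := hasGlobalMinimalModel_rat_holds (W.quadraticTwist ((NumberField.discr K : ℤ) : ℚ))
  haveI := hC
  haveI : (C • W.quadraticTwist ((NumberField.discr K : ℤ) : ℚ)).IsElliptic := by infer_instance
  rw [← zsmulAddGroupHom_natCast, natCard_ker_zsmul_baseChange_eq_of_smul_eq
    (rfl : C • W.quadraticTwist ((NumberField.discr K : ℤ) : ℚ) = _) (v.adicCompletion ℚ), hq]
  have hreg' := regularFrobDatum_two_of_smul_quadraticTwist_eq W (C • W.quadraticTwist ((NumberField.discr K : ℤ) : ℚ))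
    hd rfl hreg
  exact natCard_ker_zsmul_adicCompletion_two_pow_eq_regular (C • W.quadraticTwist ((NumberField.discr K : ℤ) : ℚ)) hℓ2
    (hasGoodReductionAtPrime_of_smul_quadraticTwist_eq W h2 hodd _ rfl hℓd hgoodℓ) hv hreg'
    (by rwa [kolyvaginIndex_eq_of_smul_quadraticTwist_eq W h2 hodd _ rfl hℓ2 hℓd hgoodℓ 2])

/-- **`duality₂` at a REGULAR Kolyvagin prime — Lemma 5.3 + Prop. 2.2 over `ℚ_ℓ` at `2` for the twin equation `E′ = W.quadraticTwist d_K`, unconditional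
form, any sign of `Δ`** (the sibling's `lemma_5_3_rat_two_quadraticTwist` with the regular twin count): for `s ∈ Sel^{(q)}(E′/ℚ)` and `d ∈ H¹(ℚ, E′[q])`
Selmer at the finite places `≠ v` and at `∞` with `2^a d` NOT Selmer at `v ∋ ℓ`, **`2^{M−1−a}·s ∈ torsionLocalKer_v(E′/ℚ)`**.
[cite: McCallumLMS1991, §5 Lemma 5.3 and §2 Prop. 2.2] [cite: MilneADT2006, Ch. I Cor. 3.4] -/
theorem lemma_5_3_rat_two_quadraticTwist_regular (h2 : Module.finrank ℚ K = 2) (hodd : Odd (NumberField.discr K))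
    [(W.quadraticTwist ((NumberField.discr K : ℤ) : ℚ)).IsElliptic]
    {M : ℕ} (hM : 1 ≤ M) {q : ℕ} (hq : q = 2 ^ M) [NeZero q]
    {ℓ : ℕ} [Fact ℓ.Prime] (hℓ2 : ℓ ≠ 2) (hℓd : ¬ ((ℓ : ℤ) ∣ NumberField.discr K))
    (hgoodℓ : W.HasGoodReductionAtPrime ℓ) {v : HeightOneSpectrum (𝓞 ℚ)} (hℓv : (ℓ : 𝓞 ℚ) ∈ v.asIdeal)
    (hreg : ∃ (𝔓 : Ideal (absIntegers (𝓞 ℚ) ℚ)) (h : absoluteGaloisGroup ℚ), 𝔓 ∈ v.primesAbove ∧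
      IsArithFrobAt (𝓞 ℚ) h 𝔓 ∧ (∀ P : geomTorsion W ((2 : ℕ) : ℤ), h • h • P = P) ∧
      ∃ u : geomTorsion W ((2 : ℕ) : ℤ), h • u ≠ u)
    (hMℓ : M ≤ Zhang2014.kolyvaginIndex W 2 ℓ)
    {s : galH1Torsion (W.quadraticTwist ((NumberField.discr K : ℤ) : ℚ)) (q : ℤ)}
    (hs : s ∈ selmerGroup (W.quadraticTwist ((NumberField.discr K : ℤ) : ℚ)) (q : ℤ))
    {d : galH1Torsion (W.quadraticTwist ((NumberField.discr K : ℤ) : ℚ)) (q : ℤ)}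
    (hdfin : ∀ w : HeightOneSpectrum (𝓞 ℚ), w ≠ v →
      d ∈ selmerLocalKer (W.quadraticTwist ((NumberField.discr K : ℤ) : ℚ)) (w.adicCompletion ℚ) (q : ℤ))
    (hdinf : ∀ w : InfinitePlace ℚ,
      d ∈ selmerLocalKer (W.quadraticTwist ((NumberField.discr K : ℤ) : ℚ)) w.Completion (q : ℤ))
    {a : ℕ} (hdv : ((2 : ℤ) ^ a) • d ∉
      selmerLocalKer (W.quadraticTwist ((NumberField.discr K : ℤ) : ℚ)) (v.adicCompletion ℚ) (q : ℤ)) :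
    ((2 : ℤ) ^ (M - 1 - a)) • s ∈
      (W.quadraticTwist ((NumberField.discr K : ℤ) : ℚ)).torsionLocalKer (v.adicCompletion ℚ) (q : ℤ) :=
  lemma_5_3_rat_two_of_card (W.quadraticTwist ((NumberField.discr K : ℤ) : ℚ)) hM hq hℓ2 hℓv
    (natCard_ker_nsmul_quadraticTwist_adicCompletion_two_pow_eq_regular W h2 hodd hℓ2 hℓd hgoodℓ hℓv hreg hMℓ hq)
    hs hdfin hdinf hdv

end Summit.BirchSwinnertonDyer.BirchSwinnertonDyer.Theorems.OffBigImageOddLocalAtTwo.Engine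

end
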